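import Summits.QuantumFields.YangMills.Theorems.BalabanUVNodesN08Thm2AsPrintedAtSlotOfRecordAC
import Summits.QuantumFields.YangMills.Theorems.BalabanUVNodesN08Thm2AtRecordWindowExact

/-!
# BalabanUVNodes ∕ N08 — [Balaban1985UV3] Thm 2 at the runs of record: THE LEVEL-0 SEAM COSTS EXACTLY THE WINDOW CONDITION — Sect.-B tower objects,
# their (41)∕(47) for `k ≥ 1` and their whole leaf systems TRANSPLANT from any tower to the record's binders (re-based `U₀`, any `εbg`),
# so the d = 3 lane's bridge (files 2–4, 9) holds WITHOUT `εbg > 2`, under file 8's necessary window `ε₁(0) ≤ εbg ∨ 2 < εbg`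

Track A, DAG node N08 = T. Bałaban, CMP **102** (1985) 255–275 [Balaban1985UV3]: (38)–(43) p. 266 (the tower objects), (41) p. 266, (47) p. 267, (1)–(7) pp. 256–257,
Thm 2 p. 272, Sects. A∕C∕D pp. 258–275 (the step leaves (22)–(36), (55)–(62)); [7] = [Balaban1985Variational] (2) p. 278.  Cell `pub-ymgap`, width seat
`pub-ymgap-dag-n08-w1` (g2), W-SEAT-START-LIST §n08 item 1 successor piece (o4) = file 11; `--supports` K1⁷ `StabilityBAtRecordR13SepCoPH` (helper).

THE POINT.  My g0's located reading (R1) «SEAM K0-BG» (`…SeamK0` §2): the d = 3 lane's towers (`U₀ := id`, ruling R-K0) re-base to the record's binders (`U₀ :=`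
[7]'s minimiser-or-junk) ONLY IF [7]'s level-0 class is everything, whence the `εbg > 2` of files 2∕3∕4∕9.  But NOTHING above level 0 reads `U₀`: the step leaves
(22)–(36)∕(55)–(62) (`B10SectAGathering.StepLeaves T k`) read the tower at levels `k + 1 ≥ 1` (and `ρ`, `χ`, `E_k`, `g_k`, the `Z`- and remainder sums), the
densities `ρ_k = T^kρ₀` never read `U_k`, and at level 0 the record's own (41)₀ ∧ (47)₀ are file 1 §2 ∕ file 8 (⟺ the window).  So:

WHAT THIS FILE PROVES (kernel; theorems only, 0 def; nothing of the paper asserted).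
* §1 `rho_congr` — densities (2) depend on `E` and the transformations only.
* §2 ★★★ `exists_transplant` — THE TRANSPLANT (any gauge group, any lattice approximation): for Sect.-B tower objects `W` and run objects `R` with the same
  minimisers ABOVE level 0, the same `E`, `ε₁`-thresholds and densities, there are tower objects `W'` with `W'.toRunObjects = R` ON THE NOSE (`U_k(V,h)` := `R.U₀`
  at level 0 ∕ `W`'s above; everything else `W`'s) such that: (41)_k ∕ (47)_k of `W'.pin` ⟺ those of `W.pin` for every `k ≥ 1`; `Pint 0`, `LF 0` are `W`'s; and
  EVERY leaf system `B10Assembly.LeafSystem C` on `W.pin.toTowerRun` yields one on `W'.pin.toTowerRun` as soon as (41)₀ ∧ (47)₀ hold for `W'` (the fourteen step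
  leaves, (46), (65)'s inputs, the large-field control for `k ≥ 1` transfer verbatim; at `k = 0` the control is `exp(−g₀⁻²A(U₀V)) ≤ 1`).
* §3 ★★ THE LANE'S BRIDGE WITHOUT `εbg > 2` (`TowerInput`s pinned to the record at `ε₁`, classes, `U_k` for `k ≥ 1`, `Σ E^{(j)}` — file 2's hypotheses minus `hε`):
  `exists_transplant_tower3` (the instance of §2), `repr41_47G_of_leafSystem_tower3_of_window` (a leaf system on the lane's pinned tower ⇒ the record's per-run datum
  `Repr41_47G … c S k`, `k ≤ K`, GIVEN ONLY `ε₁(0)(S) ≤ εbg ∨ 2 < εbg` — no sign or size condition on `εbg`, no condition on the classes),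
  `thm2Printed_of_leafSystems_tower3_of_window`, `printedUV3G_of_analyticLeaves_tower3_of_window`, `printedUV3V'_of_analyticLeaves_tower3_of_window` and — at print's
  own averaging, through file 9's transfer — `printedUV3V_of_analyticLeaves_tower3_of_window` (**`Node00.PrintedUV3V N L` itself from uniform concrete leaves, window only**).
* §4 EXACTNESS: the window is also NECESSARY for any of these conclusions (file 8, `SU(N)`, `N ≥ 2`, `εbg > 0`): `window_of_ineqs_at_record`.  The AC lane's
  version (file 4 ∕ file 9 without `εbg > 2`) is the companion file `…N08Thm2AtRecordTransplantAC`.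

HONEST FRAMING: count-neutral helper; N08 NOT discharged; the leaf systems ∕ (α)-AC rows on the lane's towers are HYPOTHESES (N08's object gap); `PrintedUV3V` NOT
proved; one finite 𝕋⁴ programme at fixed ε, Bałaban AS PRINTED — R4 closes the conditional finite-𝕋⁴ rung `BalabanLadder.UV` only; the Yang–Mills mass gap (Clay)
is NOT proved by any of this; nothing continuum ∕ ℝ⁴ ∕ OS.  No `sorry`, standard axioms.
-/

noncomputable section

namespace Summit.QuantumFields.YangMills.BalabanUVNodes.N08Thm2AtRecordTransplant

open Literature.MathematicalPhysics.QuantumFieldTheory.Balaban1983to89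
open Literature.MathematicalPhysics.QuantumFieldTheory.Balaban1983to89.B10 (Ineq41 Ineq47 TowerRun)
open Literature.MathematicalPhysics.QuantumFieldTheory.Balaban1983to89.B10SectAGathering (StepLeaves StepPieces)
open Literature.MathematicalPhysics.QuantumFieldTheory.Balaban1983to89.Node00 (SU TFamily₃)
open Literature.MathematicalPhysics.QuantumFieldTheory.Balaban1983to89.B10RunsOfRecord
open Literature.MathematicalPhysics.QuantumFieldTheory.Balaban1985CMP102
open Literature.MathematicalPhysics.QuantumFieldTheory.Balaban1985CMP102.Setting
open Literature.MathematicalPhysics.QuantumFieldTheory.Balaban1985CMP102.Theorems (Family)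
open Summit.QuantumFields.Balaban3D
open Summit.QuantumFields.Balaban3D.Proofs
open Summit.QuantumFields.YangMills.BalabanUVNodes.N08Thm2AtRecordLevelZero
open Summit.QuantumFields.YangMills.BalabanUVNodes.N08Thm2AtRecordSeamK0
open Summit.QuantumFields.YangMills.BalabanUVNodes.N08Thm2AtRecordWindowExact
open Summit.QuantumFields.YangMills.BalabanUVNodes.N08Thm2AsPrintedAtSlotOfRecordAC

/-! ## §1 The densities (2) read only `E` and the transformations -/
section Rho

variable {L : ℕ} {S : Scales L} {G : Type} [GaugeGroup G] [MeasurableSpace G] [HaarData G]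

/-- **`ρ_k = T^kρ₀` depends on `E` and `T` only** ((1)–(2)): run objects with the same averaging, transformations and `E` have the same densities, whatever their
thresholds, classes, minimisers and slots. [cite: Balaban1985UV3, (1)–(2) p.256 (bookkeeping)] -/
theorem rho_congr (R R' : RunObjects S G) (hav : R.av = R'.av) (hT : HEq R.T R'.T) (hE : R.E = R'.E) : ∀ k, R.rho k = R'.rho k := by
  obtain ⟨E, ε₁, av, T, reg, Uk, slot⟩ := R
  obtain ⟨E', ε₁', av', T', reg', Uk', slot'⟩ := R'
  cases hav; cases hE
  cases hT
  intro k
  induction k with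
  | zero => rfl
  | succ k ih =>
    show (T k).T (RunObjects.rho ⟨E, ε₁, av, T, reg, Uk, slot⟩ k) = (T k).T (RunObjects.rho ⟨E, ε₁', av, T, reg', Uk', slot'⟩ k)
    rw [ih]

end Rho

/-! ## §2 THE TRANSPLANT of Sect.-B tower objects to other run objects with the same data above level 0 -/
section Transplant

variable {L : ℕ} {S : Scales L} {G : Type} [GaugeGroup G] [MeasurableSpace G] [HaarData G]

/-- ★★★ **THE TRANSPLANT.**  Let `W` be Sect.-B tower objects and `R` run objects with the same minimisers above level 0 (`R.U_{k+1} = W.U_{k+1}`), the same `E`, the same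
thresholds `ε₁` and the same densities `ρ_k` (e.g. same averaging, transformations and `E`, `rho_congr`).  Then there are tower objects `W'` with **`W'.toRunObjects = R`**
(composite minimisers `U_k(V, h) := W`'s for `k ≥ 1` and `:= R.U₀(V)` at `k = 0` — (42) at the trivial history holds for `R`'s OWN `U₀`; histories, the functional of
(41), interaction sums, regions, `Z`-profile, remainder and vacuum-energy profiles, tower parameters := `W`'s) such that
(i) for every `k ≥ 1`: `(41)_k ∕ (47)_k` of `W'.pin` ⟺ those of `W.pin`; (ii) the k = 0 data `Pint 0`, `LF 0` are `W`'s; (iii) EVERY `B10Assembly.LeafSystem C` on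
`W.pin.toTowerRun` gives one on `W'.pin.toTowerRun` once (41)₀ ∧ (47)₀ hold there, provided `W`'s k = 0 functional is print's `LF 0 V F = exp (F ∅)` (the step leaves
(22)–(36)∕(55)–(62), (46), (65)'s inputs and the `k ≥ 1` large-field control read nothing at level 0 but `ρ`, `χ`, `E`; at `k = 0` the control is `exp(−g₀⁻²A(U₀V)) ≤ 1`).
[cite: Balaban1985UV3, (38)–(43) p.266 + (41) p.266 + (47) p.267 + Sects. A∕C pp.258–272 (bookkeeping over the typed leaves)] -/
theorem exists_transplant (W : SectB.TowerObjects S G) (R : RunObjects S G)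
    (hUk : ∀ (k : ℕ) (V : GaugeField S.P (k + 1) G), R.Uk (k + 1) V = W.Uk (k + 1) V) (hE : R.E = W.E)
    (hε₁ : ∀ k, R.ε₁ k = W.ε₁ k) (hρ : ∀ (k : ℕ) (U : GaugeField S.P k G), R.rho k U = W.rho k U)
    (hLF0 : ∀ (V : GaugeField S.P 0 G) (F : W.Hist 0 → ℝ), W.LF 0 V F = Real.exp (F (W.triv 0))) :
    ∃ W' : SectB.TowerObjects S G, W'.toRunObjects = R ∧
      (∀ k, 1 ≤ k → ((Ineq41 W'.pin.toTowerRun k ↔ Ineq41 W.pin.toTowerRun k) ∧ (Ineq47 W'.pin.toTowerRun k ↔ Ineq47 W.pin.toTowerRun k))) ∧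
      ((∀ (h : W.Hist 0) (V : GaugeField S.P 0 G), W.Pint 0 h V = 0) → ∀ (h : W'.Hist 0) (V : GaugeField S.P 0 G), W'.Pint 0 h V = 0) ∧
      (∀ (V : GaugeField S.P 0 G) (F : W'.Hist 0 → ℝ), W'.LF 0 V F = Real.exp (F (W'.triv 0))) ∧
      (∀ C : B10Assembly.Consts, B10Assembly.LeafSystem C W.pin.toTowerRun → B10.Step0Printed W'.pin.toTowerRun →
        Nonempty (B10Assembly.LeafSystem C W'.pin.toTowerRun)) := by
  -- the transplanted tower objects
  let W' : SectB.TowerObjects S G :=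
    { W with
      toRunObjects := R
      UkH := fun k => match k with
        | 0 => fun _ V => R.Uk 0 V
        | k + 1 => W.UkH (k + 1)
      UkH_triv := fun k V => by
        cases k with
        | zero => rfl
        | succ k => show W.UkH (k + 1) (W.triv (k + 1)) V = R.Uk (k + 1) V; rw [W.UkH_triv, hUk]
      E_eq := by rw [hE]; exact W.E_eq }
  -- the dictionary between the two tower runs
  have hρ' : ∀ (k : ℕ) (U : GaugeField S.P k G), W'.pin.toTowerRun.ρ k U = W.pin.toTowerRun.ρ k U := fun k U => by
    show W'.pin.rho k U = W.pin.rho k U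
    rw [SectB.TowerObjects.pin_rho, SectB.TowerObjects.pin_rho]
    exact hρ k U
  have hχ' : ∀ (k : ℕ) (U : GaugeField S.P k G), W'.pin.toTowerRun.χ k U = W.pin.toTowerRun.χ k U := fun k U => by
    show chiSmall Set.univ (R.ε₁ k) U = chiSmall Set.univ (W.ε₁ k) U
    rw [hε₁]
  -- (i) the inequalities above level 0
  have h41 : ∀ k, 1 ≤ k → (Ineq41 W'.pin.toTowerRun k ↔ Ineq41 W.pin.toTowerRun k) := by
    intro k hk
    obtain ⟨j, rfl⟩ : ∃ j, k = j + 1 := ⟨k - 1, by omega⟩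
    refine forall_congr' fun U => ?_
    rw [hρ' (j + 1) U]
    exact Iff.rfl
  have h47 : ∀ k, 1 ≤ k → (Ineq47 W'.pin.toTowerRun k ↔ Ineq47 W.pin.toTowerRun k) := by
    intro k hk
    obtain ⟨j, rfl⟩ : ∃ j, k = j + 1 := ⟨k - 1, by omega⟩
    refine forall_congr' fun U => ?_
    rw [hρ' (j + 1) U, hχ' (j + 1) U]
    exact Iff.rfl
  refine ⟨W', rfl, fun k hk => ⟨h41 k hk, h47 k hk⟩, fun hP0 h V => hP0 h V, fun V F => hLF0 V F, fun C LS hstep0 => ⟨?_⟩⟩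
  -- (iii) the leaf system: transport of the step leaves
  have h41_back : ∀ k, Ineq41 W'.pin.toTowerRun k → Ineq41 W.pin.toTowerRun k := fun k h => by
    cases k with
    | zero => exact LS.step0.1
    | succ j => exact (h41 (j + 1) (by omega)).1 h
  have h47_back : ∀ k, Ineq47 W'.pin.toTowerRun k → Ineq47 W.pin.toTowerRun k := fun k h => by
    cases k with
    | zero => exact LS.step0.2
    | succ j => exact (h47 (j + 1) (by omega)).1 h
  let SL : ∀ k, k + 1 ≤ W'.pin.toTowerRun.K → StepLeaves W'.pin.toTowerRun k := fun k hk =>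
    let Q := LS.steps k hk
    { P := { proj := Q.P.proj, proj_triv := Q.P.proj_triv, Zvol := Q.P.Zvol, Zvol_nonneg := Q.P.Zvol_nonneg, Zvol_triv := Q.P.Zvol_triv,
             starB := Q.P.starB, starT := Q.P.starT, logσ₀ := Q.P.logσ₀, dg := Q.P.dg, dg_nonneg := Q.P.dg_nonneg, logZU := Q.P.logZU,
             logZ1 := Q.P.logZ1, logZT := Q.P.logZT, logFl := Q.P.logFl, PprU := Q.P.PprU, Ppr1 := Q.P.Ppr1, PprT := Q.P.PprT,
             PY := Q.P.PY, PYZ := Q.P.PYZ, Pold := Q.P.Pold, PoldIn := Q.P.PoldIn, rem := Q.P.rem, rem_nonneg := Q.P.rem_nonneg }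
      Cz := Q.Cz, C₁ := Q.C₁, C₁' := Q.C₁', C₂ := Q.C₂, Cv := Q.Cv, C₃ := Q.C₃, C₄ := Q.C₄, C₅ := Q.C₅, c₁ := Q.c₁, C₆ := Q.C₆
      bound55 := fun h U => by
        have := Q.bound55 (h41_back k h) U
        rw [hρ' (k + 1) U]
        exact this
      bound55Lower := fun h U => by
        have := Q.bound55Lower (h47_back k h) U
        rw [hρ' (k + 1) U, hχ' (k + 1) U]
        exact this
      cumulant58 := Q.cumulant58
      cumulantLower := Q.cumulantLower
      repr33_60 := Q.repr33_60
      vacuumWhole := Q.vacuumWhole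
      decomp35_61 := Q.decomp35_61
      norm35 := Q.norm35
      starCount := Q.starCount
      oldOutside := Q.oldOutside
      pintSucc := Q.pintSucc
      estep62 := Q.estep62
      ztermSucc := Q.ztermSucc
      rmSucc := Q.rmSucc }
  exact
    { ε := LS.ε
      Tε := LS.Tε
      ε_pos := LS.ε_pos
      Tε_nonneg := LS.Tε_nonneg
      g_eq := LS.g_eq
      sites_eq := LS.sites_eq
      scale_le_one := LS.scale_le_one
      g_le_one := LS.g_le_one
      par := LS.par
      spec := SectB.TowerObjects.specOK_pin W'
      step0 := hstep0
      noInt0 := fun h U => LS.noInt0 h U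
      steps := SL
      Λvol_nonneg := LS.Λvol_nonneg
      bound46 := LS.bound46
      starT_nonneg := fun k hk => LS.starT_nonneg k hk
      starT_le := fun k hk => LS.starT_le k hk
      logσ₀_le := fun k hk => LS.logσ₀_le k hk
      dg_le := fun k hk => LS.dg_le k hk
      logZT_le := fun k hk => LS.logZT_le k hk
      PprT_le := fun k hk => LS.PprT_le k hk
      rem_eq := fun k hk => LS.rem_eq k hk
      Rm_zero := LS.Rm_zero
      Rm_succ_le := fun k hk => LS.Rm_succ_le k hk
      lf := by
        intro k hk U
        cases k with
        | succ j => exact LS.lf (j + 1) hk U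
        | zero =>
          have h0 : W'.pin.toTowerRun.LF 0 U (fun h => -(W'.pin.toTowerRun.mainT 0 h U) + W'.pin.toTowerRun.Zterm 0 h) =
              Real.exp (-(W'.pin.toTowerRun.mainT 0 (W'.pin.toTowerRun.triv 0) U) + W'.pin.toTowerRun.Zterm 0 (W'.pin.toTowerRun.triv 0)) :=
            hLF0 U _
          rw [h0, W'.pin.toTowerRun.Zterm_triv 0, add_zero]
          apply Real.exp_le_exp.mpr
          have h1 : 0 ≤ W'.pin.toTowerRun.mainT 0 (W'.pin.toTowerRun.triv 0) U := by
            rw [W'.pin.toTowerRun.mainT_triv]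
            refine mul_nonneg (sq_nonneg _) ?_
            show 0 ≤ S.actionEta 0 (R.Uk 0 U)
            unfold Scales.actionEta wilsonAction
            rw [Step0Tower.eta_zero, inv_one]
            exact Finset.sum_nonneg fun p _ =>
              mul_nonneg zero_le_one (sub_nonneg.mpr (GaugeGroup.reTr_le_one _))
          have h2 : 0 ≤ C.d * W'.pin.toTowerRun.sites 0 := mul_nonneg C.d_nonneg (W'.pin.toTowerRun.sites_nonneg 0)
          linarith }

end Transplant

/-! ## §3 The d = 3 lane's bridge WITHOUT `εbg > 2`: tower inputs pinned to the record above level 0, the window at level 0 -/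
section Lane

variable {N : ℕ} [NeZero N] {L : ℕ}

/-- The hypotheses of the transplant for the lane's stage-1 tower over inputs `D S` PINNED TO THE RECORD'S BINDERS ABOVE LEVEL 0 (`ε₁ :=` print's (7), `U_k :=`
print's minimiser-or-junk `UkA … (k+1) εbg` along the inputs' averaging, `Σ_{j<K} E^{(j)} = c.E S`; the version of (2) := the lane's selected transport): there are
tower objects EXTENDING `runObjects₀A N 𝔞_D 𝔗_D (Backgrounds.ofAvg N L 𝔞_D) c S` ON THE NOSE whose (41)∕(47) above level 0 are the lane tower's, whose k = 0 data
are print's, and which inherit every leaf system of the lane tower once (41)₀ ∧ (47)₀ hold — NO condition on `εbg`, NO condition on the classes `reg`.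
[cite: Balaban1985UV3, (1)–(7) pp.256–257 + (38)–(43) p.266 (the binders; bookkeeping)] -/
theorem exists_transplant_tower3 (D : ∀ S : Scales L, Carriers.TowerInput S (SU N)) (c : Consts L)
    (hε₁ : ∀ (S : Scales L) k, (D S).ε₁ k = eps1OfPrint c S k)
    (hUk : ∀ (S : Scales L) k (V : GaugeField S.P (k + 1) (SU N)), (D S).Uk k V = UkA N (fun S => (D S).av) S (k + 1) c.εbg V)
    (hE : ∀ S : Scales L, B10.Ek (D S).Estep S.K 0 = c.E S) (S : Scales L) :
    ∃ W' : SectB.TowerObjects S (SU N),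
      W'.toRunObjects = runObjects₀A N (fun S => (D S).av) (fun S j => (Carriers.run3 ((D S).toRunInput fun _ => True)).T j)
        (Backgrounds.ofAvg N L fun S => (D S).av) c S ∧
      (∀ k, 1 ≤ k → ((Ineq41 W'.pin.toTowerRun k ↔ Ineq41 (D S).tower3.toTowerRun k) ∧ (Ineq47 W'.pin.toTowerRun k ↔ Ineq47 (D S).tower3.toTowerRun k))) ∧
      ((∀ (h : Carriers.Hist S.P 0) (V : GaugeField S.P 0 (SU N)), (D S).Pint 0 h V = 0) → ∀ (h : W'.Hist 0) (V : GaugeField S.P 0 (SU N)), W'.Pint 0 h V = 0) ∧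
      (∀ (V : GaugeField S.P 0 (SU N)) (F : W'.Hist 0 → ℝ), W'.LF 0 V F = Real.exp (F (W'.triv 0))) ∧
      (∀ C : B10Assembly.Consts, B10Assembly.LeafSystem C (D S).tower3.toTowerRun → B10.Step0Printed W'.pin.toTowerRun →
        Nonempty (B10Assembly.LeafSystem C W'.pin.toTowerRun)) := by
  refine exists_transplant ((D S).towerWith fun _ => True) _ (fun k V => ?_) (hE S).symm (fun k => (hε₁ S k).symm) (fun k U => ?_)
    (fun V F => Carriers.lf_zero (D S).W V F)
  · show UkA N (fun S => (D S).av) S (k + 1) c.εbg V = (Carriers.run3 ((D S).toRunInput fun _ => True)).Uk (k + 1) V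
    rw [Carriers.TowerInput.ukAll_eq]
    exact (hUk S k V).symm
  · exact congrFun (rho_congr
      (runObjects₀A N (fun S => (D S).av) (fun S j => (Carriers.run3 ((D S).toRunInput fun _ => True)).T j)
        (Backgrounds.ofAvg N L fun S => (D S).av) c S)
      ((D S).towerWith fun _ => True).toRunObjects rfl HEq.rfl (hE S).symm k) U

/-- ★★ **THE RECORD'S PER-RUN DATUM FROM A LEAF SYSTEM ON THE LANE'S PINNED TOWER, GIVEN ONLY THE LEVEL-0 WINDOW** (`ε₁(0)(S) ≤ εbg ∨ 2 < εbg`; any `εbg`, any classes):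
file 2's `repr41_47G_of_leafSystem_tower3` with `εbg > 2` replaced by file 8's NECESSARY window condition.  The leaf system's `noInt0` is (43)@0; (41)₀ for every `V` and
(47)₀ from the window (file 1 §2) hold for the transplanted objects, which then inherit the whole leaf system (§2). [cite: Balaban1985UV3, Thm 2 p.272 + (41) p.266 + (47) p.267 + (4), (7) pp.256–257] -/
theorem repr41_47G_of_leafSystem_tower3_of_window (D : ∀ S : Scales L, Carriers.TowerInput S (SU N)) (c : Consts L)
    (hε₁ : ∀ (S : Scales L) k, (D S).ε₁ k = eps1OfPrint c S k)
    (hUk : ∀ (S : Scales L) k (V : GaugeField S.P (k + 1) (SU N)), (D S).Uk k V = UkA N (fun S => (D S).av) S (k + 1) c.εbg V)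
    (hE : ∀ S : Scales L, B10.Ek (D S).Estep S.K 0 = c.E S) {S : Scales L} (hwin : eps1OfPrint c S 0 ≤ c.εbg ∨ 2 < c.εbg)
    {C : B10Assembly.Consts} (LS : B10Assembly.LeafSystem C (D S).tower3.toTowerRun) (k : ℕ) (hk : k ≤ S.K) :
    Repr41_47G N (runObjects₀A N (fun S => (D S).av) (fun S j => (Carriers.run3 ((D S).toRunInput fun _ => True)).T j)
      (Backgrounds.ofAvg N L fun S => (D S).av)) c S k := by
  obtain ⟨W', hW', -, hP0, hLF, hLS⟩ := exists_transplant_tower3 D c hε₁ hUk hE S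
  have hP0' : ∀ (h : W'.Hist 0) (V : GaugeField S.P 0 (SU N)), W'.Pint 0 h V = 0 := hP0 fun h V => LS.noInt0 h V
  have hstep0 : B10.Step0Printed W'.pin.toTowerRun :=
    ⟨ineq41_zero hW' hP0' fun V F => (hLF V F).symm.le,
      ineq47_zero_of_window hW' hP0' fun V hV => hwin.elim
        (fun h => (plaqSmall_eta_zero_iff N S c.εbg V).2 (plaqSmall_mono h hV)) (fun h => plaqSmall_level_zero_of_two_lt N S h V)⟩
  obtain ⟨LS'⟩ := hLS C LS hstep0
  exact Theorems.BalabanUVNodesN08RelativeTo5.repr41_47G_of_leafSystem N _ c W' hW' LS' k hk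

/-- ★★ **THE RECORD'S Thm-2 CONJUNCT at the inputs' averaging FROM LEAF SYSTEMS ON THE LANE'S PINNED TOWERS, given the window at every member** (per-run `C_S` suffice;
file 2's `thm2Printed_of_leafSystems_tower3` without `εbg > 2`). [cite: Balaban1985UV3, Thm 2 p.272] -/
theorem thm2Printed_of_leafSystems_tower3_of_window (D : ∀ S : Scales L, Carriers.TowerInput S (SU N)) (c : Consts L)
    (hε₁ : ∀ (S : Scales L) k, (D S).ε₁ k = eps1OfPrint c S k)
    (hUk : ∀ (S : Scales L) k (V : GaugeField S.P (k + 1) (SU N)), (D S).Uk k V = UkA N (fun S => (D S).av) S (k + 1) c.εbg V)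
    (hE : ∀ S : Scales L, B10.Ek (D S).Estep S.K 0 = c.E S)
    (hwin : ∀ S : Family L c.eps0, eps1OfPrint c S.1 0 ≤ c.εbg ∨ 2 < c.εbg)
    (h : ∀ S : Family L c.eps0, ∃ C : B10Assembly.Consts, Nonempty (B10Assembly.LeafSystem C (D S.1).tower3.toTowerRun)) :
    B10.Thm2Printed (runsAtG N (runObjects₀A N (fun S => (D S).av) (fun S j => (Carriers.run3 ((D S).toRunInput fun _ => True)).T j)
      (Backgrounds.ofAvg N L fun S => (D S).av)) c) := by
  intro S k hk
  obtain ⟨C, ⟨LS⟩⟩ := h S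
  exact repr41_47G_of_leafSystem_tower3_of_window D c hε₁ hUk hE (hwin S) LS k hk

/-- ★★ **THE PRINTED PAIR `PrintedUV3G` at the inputs' averaging FROM UNIFORM CONCRETE LEAVES on the lane's towers pinned to the record above level 0** (admissible `c`,
the window at every member — e.g. file 5's coupling ceiling, or `εbg > 2`; ONE `C`): file 2's `printedUV3G_of_analyticLeaves_tower3` without `εbg > 2`.
[cite: Balaban1985UV3, Thm 1 p.257 + Thm 2 p.272 + pp.256–274 (the leaves)] -/
theorem printedUV3G_of_analyticLeaves_tower3_of_window (D : ∀ S : Scales L, Carriers.TowerInput S (SU N)) (c : Consts L) (hc : c.Adm)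
    (hε₁ : ∀ (S : Scales L) k, (D S).ε₁ k = eps1OfPrint c S k)
    (hUk : ∀ (S : Scales L) k (V : GaugeField S.P (k + 1) (SU N)), (D S).Uk k V = UkA N (fun S => (D S).av) S (k + 1) c.εbg V)
    (hE : ∀ S : Scales L, B10.Ek (D S).Estep S.K 0 = c.E S)
    (hwin : ∀ S : Family L c.eps0, eps1OfPrint c S.1 0 ≤ c.εbg ∨ 2 < c.εbg)
    {C : B10Assembly.Consts} (hC : Constants.NormalisedConsts L C)
    (hUC : ∀ S : Family L c.eps0, EndTheorem.UsesConsts C ((D S.1).towerWith fun _ => True))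
    (A : ∀ S : Family L c.eps0, UVStability3D.AnalyticLeaves C S.1 (D S.1).tower3.toTowerRun) :
    PrintedUV3G N L (runObjects₀A N (fun S => (D S).av) (fun S j => (Carriers.run3 ((D S).toRunInput fun _ => True)).T j)
      (Backgrounds.ofAvg N L fun S => (D S).av)) := by
  refine printedUV3G_of_uniformLeafSystems N L _ ⟨c, hc, C, fun S => ?_⟩
  obtain ⟨W', hW', -, hP0, hLF, hLS⟩ := exists_transplant_tower3 D c hε₁ hUk hE S.1
  have LS : B10Assembly.LeafSystem C (D S.1).tower3.toTowerRun :=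
    UVStability3D.leafSystem_of_concrete hC ⟨EndTheorem.carrierEqs_pin _ (hUC S), A S⟩
  have hP0' : ∀ (h : W'.Hist 0) (V : GaugeField S.1.P 0 (SU N)), W'.Pint 0 h V = 0 := hP0 fun h V => LS.noInt0 h V
  have hstep0 : B10.Step0Printed W'.pin.toTowerRun :=
    ⟨ineq41_zero hW' hP0' fun V F => (hLF V F).symm.le,
      ineq47_zero_of_window hW' hP0' fun V hV => (hwin S).elim
        (fun h => (plaqSmall_eta_zero_iff N S.1 c.εbg V).2 (plaqSmall_mono h hV)) (fun h => plaqSmall_level_zero_of_two_lt N S.1 h V)⟩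
  exact ⟨W', hW', hLS C LS hstep0⟩

/-- ★ **THE PRIMED SLOT `Node00.PrintedUV3V' N L` FROM UNIFORM CONCRETE LEAVES on the lane's towers pinned to the record above level 0, along an admissible averaging**,
admissible `c`, the window at every member (file 2's `printedUV3V'_of_analyticLeaves_tower3` without `εbg > 2`). [cite: Balaban1985UV3, Thm 1 p.257 + Thm 2 p.272] -/
theorem printedUV3V'_of_analyticLeaves_tower3_of_window (D : ∀ S : Scales L, Carriers.TowerInput S (SU N))
    (h𝔞 : Node00.AvgAdmissible₃ N fun S => (D S).av) (c : Consts L) (hc : c.Adm)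
    (hε₁ : ∀ (S : Scales L) k, (D S).ε₁ k = eps1OfPrint c S k)
    (hUk : ∀ (S : Scales L) k (V : GaugeField S.P (k + 1) (SU N)), (D S).Uk k V = UkA N (fun S => (D S).av) S (k + 1) c.εbg V)
    (hE : ∀ S : Scales L, B10.Ek (D S).Estep S.K 0 = c.E S)
    (hwin : ∀ S : Family L c.eps0, eps1OfPrint c S.1 0 ≤ c.εbg ∨ 2 < c.εbg)
    {C : B10Assembly.Consts} (hC : Constants.NormalisedConsts L C)
    (hUC : ∀ S : Family L c.eps0, EndTheorem.UsesConsts C ((D S.1).towerWith fun _ => True))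
    (A : ∀ S : Family L c.eps0, UVStability3D.AnalyticLeaves C S.1 (D S.1).tower3.toTowerRun) : Node00.PrintedUV3V' N L :=
  ⟨fun S => (D S).av, h𝔞, fun S j => (Carriers.run3 ((D S).toRunInput fun _ => True)).T j,
    printedUV3G_of_analyticLeaves_tower3_of_window D c hc hε₁ hUk hE hwin hC hUC A⟩

/-- ★★ **THE SLOT OF RECORD `Node00.PrintedUV3V N L` ITSELF from uniform concrete leaves on the lane's towers AT PRINT'S OWN AVERAGING pinned to the record above
level 0**, admissible `c`, the window at every member — NO `εbg > 2` (file 9 §1's transfer `exists_TFamily₃_of_av_eq` supplies the version `𝔗` of (2)).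
[cite: Balaban1985UV3, Thm 1 p.257 + Thm 2 p.272 + pp.256–274 (the leaves); Balaban1985Averaging, (15) p.19] -/
theorem printedUV3V_of_analyticLeaves_tower3_of_window (D : ∀ S : Scales L, Carriers.TowerInput S (SU N)) (hav : ∀ S, (D S).av = avOfPrint N S)
    (c : Consts L) (hc : c.Adm) (hε₁ : ∀ (S : Scales L) k, (D S).ε₁ k = eps1OfPrint c S k)
    (hUk : ∀ (S : Scales L) k (V : GaugeField S.P (k + 1) (SU N)), (D S).Uk k V = UkA N (fun S => (D S).av) S (k + 1) c.εbg V)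
    (hE : ∀ S : Scales L, B10.Ek (D S).Estep S.K 0 = c.E S)
    (hwin : ∀ S : Family L c.eps0, eps1OfPrint c S.1 0 ≤ c.εbg ∨ 2 < c.εbg)
    {C : B10Assembly.Consts} (hC : Constants.NormalisedConsts L C)
    (hUC : ∀ S : Family L c.eps0, EndTheorem.UsesConsts C ((D S.1).towerWith fun _ => True))
    (A : ∀ S : Family L c.eps0, UVStability3D.AnalyticLeaves C S.1 (D S.1).tower3.toTowerRun) : Node00.PrintedUV3V N L := by
  obtain ⟨𝔗', h'⟩ := exists_TFamily₃_of_av_eq (N := N) (funext hav) (fun S j => (Carriers.run3 ((D S).toRunInput fun _ => True)).T j)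
  have hR : runObjects₀A N (fun S => (D S).av) (fun S j => (Carriers.run3 ((D S).toRunInput fun _ => True)).T j)
      (Backgrounds.ofAvg N L fun S => (D S).av) = runObjects₀T N 𝔗' (Backgrounds.ofPrint N L) :=
    funext fun c => funext fun S => h' c S
  exact ⟨𝔗', hR ▸ printedUV3G_of_analyticLeaves_tower3_of_window D c hc hε₁ hUk hE hwin hC hUC A⟩

end Lane

/-! ## §4 Exactness: the window is NECESSARY for every conclusion above -/
section Exact

variable {N : ℕ} [NeZero N] {L : ℕ} {𝔞 : ∀ S : Scales L, ∀ j, Averaging S.P j (SU N)}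
  {𝔗 : ∀ S : Scales L, ∀ j, RTOpI S.P j (SU N) (𝔞 S j)} {c : Consts L} {S : Scales L}

/-- **The window is NECESSARY** (file 8): tower objects extending the record's binders with print's k = 0 interaction data and (47)₀ exist ONLY IF `ε₁(0)(S) ≤ εbg ∨ 2 < εbg`
(`SU(N)`, `N ≥ 2`, `εbg > 0`).  So §3–§4 hold under the EXACT hypothesis. [cite: Balaban1985UV3, (47) p.267 + (4), (7) pp.256–257] -/
theorem window_of_ineqs_at_record (hN : 2 ≤ N) (hε : 0 < c.εbg)
    (h : ∃ W : SectB.TowerObjects S (SU N), W.toRunObjects = runObjects₀A N 𝔞 𝔗 (Backgrounds.ofAvg N L 𝔞) c S ∧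
      (∀ (h : W.Hist 0) (V : GaugeField S.P 0 (SU N)), W.Pint 0 h V = 0) ∧ Ineq47 W.pin.toTowerRun 0) :
    eps1OfPrint c S 0 ≤ c.εbg ∨ 2 < c.εbg := by
  obtain ⟨W, hW, hP0, h47⟩ := h
  exact (ineq47_zero_iff_consts hN hW hP0 hε).1 h47

end Exact

end Summit.QuantumFields.YangMills.BalabanUVNodes.N08Thm2AtRecordTransplant

end
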